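import Mathlib.Logic.Denumerable
import Summits.RiemannHypothesis.RiemannHypothesis.Theorems.SpectralTraceWindowStepRungCorridor
import HarnessLib

/-!
# A window trace IS a design: `Trace(B) ⇒ DesignsAt B` (crux `WindowStep`, line `split-birth`, calibration)

Support file for the crux `stmt-RiemannHypothesis-14659`
(`Summit.RiemannHypothesis.RiemannHypothesis.Theses.SpectralTrace.WindowStep`), line `split-birth`
(registered helper `designsAt_of_windowTrace`). It completes the skeleton's calibration of the
RH-bearing stub `stub_regularDesigns` (`∀ B > log 3, WindowTracePrime2 → 0 < ε(B/2) → DesignsAt B`):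
every real family reproducing the Weil functional on the Weil tests of `[-B, B]` is ALREADY a design
at level `B` with displacement budget `D = 0` — enumerate its (countably infinitely many) indices
by `ℕ`; the polynomial local count profile (indeed `≤ C (1 + |T|)`) is the upper local Weyl law
`card_near_le_log_of_windowTrace`. Hence `DesignsAt B ↔ Trace(B)` for `B ≥ log 2` (with the landed
`stub_designReduction`), `stub_regularDesigns` follows from the child `CrystRegular`, hence from the
crux and from RH: nothing registered on the interior side is stronger than the crux.

Ingredients (all landed): local finiteness and countability of the index type from
`card_near_le_log_of_windowTrace` (every real is within `1` of an integer); infinitude from the lower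
local Weyl law `exists_near_of_windowTrace` (the family meets every far window); `ℕ ≃ ι`
(`nonempty_equiv_of_countable`) and `Equiv.hasSum_iff`.
-/

set_option linter.dupNamespace false

noncomputable section

open Complex Set Filter

namespace Summit.RiemannHypothesis.RiemannHypothesis.Theorems.SpectralTraceWindowStep

open Literature.NumberTheory.LFunctions
open Summit.RiemannHypothesis.RiemannHypothesis.Theorems.WindowTraceArch.Negative

variable {A : ℝ} {ι : Type} {γ : ι → ℝ}

/-- A window-trace family has finitely many indices within `1` of any height (upper local Weyl law).
[folklore] -/
theorem finite_near_of_windowTrace (hA : 0 < A)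
    (h : ∀ g : ℝ → ℂ, IsWeilTest g → tsupport g ⊆ Icc (-A) A →
      HasSum (fun i => weilMellin g (1 / 2 + (γ i : ℂ) * I)) (weilFunctional g)) (T : ℝ) :
    {i : ι | |γ i - T| ≤ 1}.Finite := by
  obtain ⟨C, _, hcard⟩ := card_near_le_log_of_windowTrace hA h
  by_contra hinf
  obtain ⟨n, hn⟩ := exists_nat_gt (C * (1 + Real.log (1 + |T|)))
  obtain ⟨s, hs, hscard⟩ := (Set.not_finite.1 hinf).exists_subset_card_eq n
  have := hcard T s fun i hi => hs (Finset.mem_coe.2 hi)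
  rw [hscard] at this
  linarith

/-- The index type of a window-trace family is countable (it is covered by the finite sets of indices
within `1` of an integer). [folklore] -/
theorem countable_of_windowTrace (hA : 0 < A)
    (h : ∀ g : ℝ → ℂ, IsWeilTest g → tsupport g ⊆ Icc (-A) A →
      HasSum (fun i => weilMellin g (1 / 2 + (γ i : ℂ) * I)) (weilFunctional g)) :
    Countable ι := by
  have hcov : (univ : Set ι) = ⋃ m : ℤ, {i : ι | |γ i - m| ≤ 1} := by
    ext i
    simp only [mem_univ, mem_iUnion, mem_setOf_eq, true_iff]
    refine ⟨⌊γ i⌋, ?_⟩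
    rw [abs_le]
    constructor <;> linarith [Int.floor_le (γ i), Int.lt_floor_add_one (γ i)]
  rw [← countable_univ_iff, hcov]
  exact countable_iUnion fun m => (finite_near_of_windowTrace hA h m).countable

/-- The index type of a window-trace family is infinite (lower local Weyl law: the family meets every
far window). [folklore] -/
theorem infinite_of_windowTrace (hA : 0 < A)
    (h : ∀ g : ℝ → ℂ, IsWeilTest g → tsupport g ⊆ Icc (-A) A →
      HasSum (fun i => weilMellin g (1 / 2 + (γ i : ℂ) * I)) (weilFunctional g)) :
    Infinite ι := by
  obtain ⟨R, c, C, hR, hc, hnear⟩ := exists_near_of_windowTrace hA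
  by_contra hfin
  rw [not_infinite_iff_finite] at hfin
  obtain ⟨M, hM⟩ := (Set.finite_range γ).bddAbove
  set T : ℝ := max (M + R + 1) (Real.exp ((C + 1) / c)) with hT
  have hT1 : M + R + 1 ≤ T := le_max_left _ _
  have hTpos : 0 < T := lt_of_lt_of_le (Real.exp_pos _) (le_max_right _ _)
  have hlog : (C + 1) / c ≤ Real.log (1 + |T|) := by
    rw [abs_of_pos hTpos]
    calc (C + 1) / c = Real.log (Real.exp ((C + 1) / c)) := (Real.log_exp _).symm
      _ ≤ Real.log (1 + T) := Real.log_le_log (Real.exp_pos _) (by linarith [le_max_right (M + R + 1) (Real.exp ((C + 1) / c))])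
  have hpos : 0 < c * Real.log (1 + |T|) - C := by
    have : C + 1 ≤ c * Real.log (1 + |T|) := by
      rw [div_le_iff₀ hc] at hlog; linarith
    linarith
  obtain ⟨i, hi⟩ := hnear ι γ h T hpos
  have hiM : γ i ≤ M := hM ⟨i, rfl⟩
  rw [abs_le] at hi
  linarith [hi.1]

/-- **A window trace is a design with budget `0`** (registered helper `designsAt_of_windowTrace`):
if some real family reproduces the Weil functional on the Weil tests supported in `[-B, B]` (`B > 0`),
then there are an enumeration `x : ℕ → ℝ` of it with polynomial local count profile
(`#{n : |x n − T| ≤ 1} ≤ C (1 + |T|)`) and the budget `D = 0` such that every finite list of level-`B`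
tests is reproduced exactly by `x` itself. [folklore] -/
theorem designsAt_of_windowTrace : ∀ B : ℝ, 0 < B → (∃ (ι : Type) (γ : ι → ℝ), ∀ g : ℝ → ℂ, Literature.NumberTheory.LFunctions.IsWeilTest g → tsupport g ⊆ Set.Icc (-B) B → HasSum (fun i => Literature.NumberTheory.LFunctions.weilMellin g (1 / 2 + (γ i : ℂ) * Complex.I)) (Literature.NumberTheory.LFunctions.weilFunctional g)) → ∃ (x : ℕ → ℝ) (C : ℝ) (N : ℕ), (∀ (T : ℝ) (s : Finset ℕ), (∀ n ∈ s, |x n - T| ≤ 1) → (s.card : ℝ) ≤ C * (1 + |T|) ^ N) ∧ ∃ D : ℝ, ∀ (g : ℕ → ℝ → ℂ) (m : ℕ), (∀ j, Literature.NumberTheory.LFunctions.IsWeilTest (g j) ∧ tsupport (g j) ⊆ Set.Icc (-B) B) → ∃ δ : ℕ → ℝ, (∀ n, |δ n| ≤ D) ∧ ∀ j < m, HasSum (fun n => Literature.NumberTheory.LFunctions.weilMellin (g j) (1 / 2 + ((x n + δ n : ℝ) : ℂ) * Complex.I)) (Literature.NumberTheory.LFunctions.weilFunctional (g j)) := by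
  rintro B hB ⟨ι, γ, h⟩
  haveI : Countable ι := countable_of_windowTrace hB h
  haveI : Infinite ι := infinite_of_windowTrace hB h
  obtain ⟨e⟩ := (nonempty_equiv_of_countable : Nonempty (ℕ ≃ ι))
  obtain ⟨C, _, hcard⟩ := card_near_le_log_of_windowTrace hB h
  refine ⟨fun n => γ (e n), C, 1, ?_, 0, ?_⟩
  · intro T s hs
    classical
    have himg : ∀ i ∈ s.image e, |γ i - T| ≤ 1 := by
      intro i hi
      obtain ⟨n, hn, rfl⟩ := Finset.mem_image.1 hi
      exact hs n hn
    have h1 := hcard T (s.image e) himg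
    rw [Finset.card_image_of_injective _ e.injective] at h1
    have hlog : Real.log (1 + |T|) ≤ |T| := by
      have := Real.log_le_sub_one_of_pos (by positivity : (0 : ℝ) < 1 + |T|)
      linarith
    have hC0 : 0 ≤ C := by
      have := hcard T ∅ (by simp)
      simp at this
      nlinarith [Real.log_nonneg (by linarith [abs_nonneg T] : (1 : ℝ) ≤ 1 + |T|)]
    rw [pow_one]
    nlinarith
  · intro g m hg
    refine ⟨fun _ => 0, fun _ => by simp, fun j _ => ?_⟩
    have hs := (e.hasSum_iff (f := fun i => weilMellin (g j) (1 / 2 + (γ i : ℂ) * I))).2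
      (h (g j) (hg j).1 (hg j).2)
    refine hs.congr_fun fun n => ?_
    simp [Function.comp]

end Summit.RiemannHypothesis.RiemannHypothesis.Theorems.SpectralTraceWindowStep

end
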